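import Literature.NumberTheory.LFunctions.Zhang2022.EllRegimeStatements
import Literature.NumberTheory.LFunctions.Zhang2022.MainTermFormH1

/-!
# Zhang (2022) design-space objective, twin part 7: the frame scaling law of `F_ℓ` and the sign of the
# main term of the one-piece positivity endgame in the physical frame

Y. Zhang, *Discrete mean estimates and the Landau–Siegel zero*, arXiv:2211.02515v1 (2022)
[Zhang2022LandauSiegel] — an unrefereed manuscript under adjudication. **This file SEARCHES and TYPES; it
makes no claim about Landau–Siegel zeros, about Theorems 1–2 of the manuscript, or about a repaired (2.32),
until a kernel theorem says so.** LANDAU–SIEGEL programme, cell `landau-siegel`, §A Lean twin (ls-obj-eng-3) for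
the B-ell block «K₀-POS» / the one-profile positivity endgame of `EllRegimeStatements`
(`EllRegime.theorem1_of_ellDictProfile`, `theorem1_of_ellDictK0`), whose closing hypothesis is

  `hneg : ∃ D₁, ∀ S, D₁ ≤ S.D → S.IsEllRegimeP A → ∀ λ, |λ| ≤ Λ →`
  `         F_{ℓ(P)}(rescale (L_M/L_R) g) + (G₀ + λG₁)/A + K/A² < 0`

(`F_ℓ = mainTermFormEll ℓ`, `ℓ(P) = Scales.ellP`, `L_M/L_R = Scales.shrink`: the FRAME RULE of record, theory
2026-08-26T17:10:30Z, B-ell RULING-2 18:12:09Z «frame of record = physical data»). This file proves: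

* `mainTermFormEll_rescale` — the **scaling law**: for a one-piece profile `G` on `[0,1]` extended by zero with
  `G(1) = 0` (`OnePieceWV G G'`) and `0 < r ≤ 1`,
  `F_ℓ(rescale r G) = r⁻¹·F_{ℓr}(G)` (the four homogeneity classes of `mainTermFormEll` pick up `r⁻¹, 1, r, r²`;
  the wall value enters only through `G(1) = 0`); hence `F_s(G) = s·𝔅(rescale s G)` for `0 < s ≤ 1`
  (`mainTermFormEll_eq_mul_mainTermForm_rescale`) and `F_ℓ(rescale r G) = ℓ·𝔅(rescale (ℓr) G)` whenever
  `ℓr ≤ 1` (`mainTermFormEll_rescale_eq_mul_mainTermForm`);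
* `isH1_rescale` — `rescale s G` is an `H¹[0,1]` profile (continuous glue at `y = s` BECAUSE `G(1) = 0`), so by
  `mainTermForm_nonneg_of_isH1` (`MainTermFormH1`, the PSD theorem of record):
  `mainTermFormEll_rescale_nonneg` — **`F_ℓ(rescale r G) ≥ 0` whenever `ℓ·r ≤ 1`**;
* `Scales.ellP_mul_shrink` — in the typed frame the total rescale is `ℓ(P)·(L_M/L_R) = log P/L_Δ(P)`, and
  `IsEllRegimeP.frame_bounds` — in the regime (`D ≥ 7`, `A > 0`): `0 < shrink ≤ 1`, `0 < ℓ(P)`,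
  `0 < ℓ(P)·shrink < 1` IDENTICALLY (`L_Δ(P) = log P + ½log D + log t₀ > log P`; limit value `A/(A+½)`);
* `IsEllRegimeP.mainTerm_rescale_nonneg` — hence the main term of `hneg` is `≥ 0` for EVERY one-piece
  wall-vanishing profile, every `A > 0`, every `D ≥ 7`; and `IsEllRegimeP.dict_neg_of_hneg` — `hneg` at a scale
  record forces `(G₀ + λG₁)/A + K/A² < 0` for all `|λ| ≤ Λ`: a one-piece POS design closes in the physical frame
  ONLY through a negative first-order dictionary term (registry row E-022), never through the main-term form.

So the `ℓ > 1` knife edge (`mainTermFormEll_neg_of_one_lt`: `F_ℓ(k₁) < 0` for `ℓ > 1`) is not reached by one-piece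
full-length profiles once the frame factor is applied: the effective parameter is `L_M/L_Δ < 1`, on the PSD side.
(Numerics of record agreeing with the sign: B-ell «K₀^P OBJ_pos > 0», lineage B, cell STATUS 2026-08-26T18:13:14Z;
lineage A EXACT-SCALES «the support shrink neutralises the ℓ-lever», INBOX 17:39:55Z.) STATUS OF THE OBJECTS as in
`MainTermFormEll` / `EllRegimeStatements`: continued main-term calculus at free scales; the dictionary rows are open
and asserted by no one here. One new `Prop`-valued structure (`OnePieceWV`, the profile class); theorems otherwise.
-/

noncomputable section

open Real Complex ComplexConjugate MeasureTheory Set intervalIntegral Filter Topology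

namespace Literature.NumberTheory.LFunctions.Zhang2022

namespace EllRegime

/-! ## The profile class: one piece on `[0,1]`, extended by zero, vanishing at the wall -/

/-- **One-piece wall-vanishing profile data** `(G, G′)` on `ℝ`: `G` continuous with `G = 0` on `[1, ∞)` (so
`G(1⁻) = 0`: the wall-vanishing condition IS continuity across `y = 1`), right derivative `G′` at every `x > 0`
with `G′ = 0` on `[1, ∞)`, `G′` measurable and bounded — the shape of the cell's one-piece `expComb`/PPE designs
of full length `P` with `g(1⁻) = 0` (B-ell designs ell-K0-pos-001…003). [cite: Zhang2022LandauSiegel, §2 (2.23)–(2.25)] -/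
structure OnePieceWV (G G' : ℝ → ℂ) : Prop where
  /-- `G` is continuous on `ℝ` -/
  continuous : Continuous G
  /-- `G = 0` on `[1, ∞)` -/
  eq_zero : ∀ y, 1 ≤ y → G y = 0
  /-- `G′ = 0` on `[1, ∞)` -/
  deriv_eq_zero : ∀ y, 1 ≤ y → G' y = 0
  /-- `G′(x)` is the right derivative of `G` at every `x > 0` -/
  hasDerivWithinAt : ∀ x, 0 < x → HasDerivWithinAt G (G' x) (Ioi x) x
  /-- `G′` is measurable -/
  measurable : Measurable G'
  /-- `G′` is bounded -/
  bounded : ∃ C, ∀ y, ‖G' y‖ ≤ C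

namespace OnePieceWV

variable {G G' : ℝ → ℂ}

/-- A bounded measurable function is interval integrable. [folklore] -/
private theorem intervalIntegrable_of_bdd {F : ℝ → ℂ} (hm : Measurable F) {C : ℝ} (hC : ∀ y, ‖F y‖ ≤ C)
    (a b : ℝ) : IntervalIntegrable F volume a b := by
  rw [intervalIntegrable_iff]
  exact Measure.integrableOn_of_bounded measure_Ioc_lt_top.ne hm.aestronglyMeasurable
    (ae_of_all _ fun y => hC y)

/-- `G` is interval integrable. [folklore] -/
private theorem intervalIntegrable (h : OnePieceWV G G') (a b : ℝ) : IntervalIntegrable G volume a b :=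
  h.continuous.intervalIntegrable a b

/-- `G′` is interval integrable. [folklore] -/
private theorem intervalIntegrable' (h : OnePieceWV G G') (a b : ℝ) : IntervalIntegrable G' volume a b := by
  obtain ⟨C, hC⟩ := h.bounded
  exact intervalIntegrable_of_bdd h.measurable hC a b

/-- `‖G′‖²` is interval integrable. [folklore] -/
private theorem intervalIntegrable_normSq' (h : OnePieceWV G G') (a b : ℝ) :
    IntervalIntegrable (fun y => ((‖G' y‖ ^ 2 : ℝ) : ℂ)) volume a b := by
  obtain ⟨C, hC⟩ := h.bounded
  have hm : Measurable fun y => ((‖G' y‖ ^ 2 : ℝ) : ℂ) :=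
    Complex.measurable_ofReal.comp ((h.measurable.norm).pow_const 2)
  refine intervalIntegrable_of_bdd hm (C := C ^ 2) (fun y => ?_) a b
  rw [Complex.norm_real, Real.norm_eq_abs, abs_pow, abs_norm]
  exact pow_le_pow_left₀ (norm_nonneg _) (hC y) 2

/-- `G′·conj G` is interval integrable. [folklore] -/
private theorem intervalIntegrable_deriv_mul_conj (h : OnePieceWV G G') (a b : ℝ) :
    IntervalIntegrable (fun y => G' y * conj (G y)) volume a b :=
  (h.intervalIntegrable' a b).mul_continuousOn (Complex.continuous_conj.comp h.continuous).continuousOn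

/-- `G·conj(∫₀ʸ G)` is interval integrable. [folklore] -/
private theorem intervalIntegrable_mul_conj_primitive (h : OnePieceWV G G') (a b : ℝ) :
    IntervalIntegrable (fun y => G y * conj (∫ t in (0:ℝ)..y, G t)) volume a b :=
  (h.continuous.mul (Complex.continuous_conj.comp
    (intervalIntegral.continuous_primitive (fun a b => h.intervalIntegrable a b) 0))).intervalIntegrable a b

end OnePieceWV

/-! ## The scaling law -/

/-- Change of variables for an integrand supported in `[0,1]`: `∫₀¹ F(y/r) dy = r·∫₀¹ F` for `0 < r ≤ 1`.
[folklore] -/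
private theorem integral_comp_div_unit {F : ℝ → ℂ} {r : ℝ} (hr : 0 < r) (hr1 : r ≤ 1)
    (hF : ∀ y, 1 ≤ y → F y = 0) (hFi : IntervalIntegrable F volume 0 1) :
    ∫ y in (0:ℝ)..1, F (y / r) = (r : ℂ) * ∫ y in (0:ℝ)..1, F y := by
  rw [intervalIntegral.integral_comp_div F hr.ne', zero_div, Complex.real_smul]
  have h1r : (1 : ℝ) ≤ 1 / r := by rw [le_div_iff₀ hr, one_mul]; exact hr1
  have h2 : IntervalIntegrable F volume 1 (1 / r) := by
    refine (intervalIntegrable_const (c := (0 : ℂ))).congr ?_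
    intro y hy
    rw [uIoc_of_le h1r] at hy
    exact (hF y hy.1.le).symm
  have h3 : ∫ y in (1:ℝ)..(1 / r), F y = 0 := by
    rw [intervalIntegral.integral_congr (g := fun _ => (0 : ℂ)) ?_, intervalIntegral.integral_zero]
    intro y hy
    rw [uIcc_of_le h1r] at hy
    exact hF y hy.1
  rw [← intervalIntegral.integral_add_adjacent_intervals hFi h2, h3, add_zero]

variable {G G' : ℝ → ℂ}

/-- `∫₀¹ ‖(rescale′ r G′)‖² = r⁻¹·∫₀¹ ‖G′‖²`. [cite: Zhang2022LandauSiegel, §2 (2.10), (2.30)] -/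
theorem integral_normSq_rescale' (h : OnePieceWV G G') {r : ℝ} (hr : 0 < r) (hr1 : r ≤ 1) :
    ∫ y in (0:ℝ)..1, ‖rescale' r G' y‖ ^ 2 = r⁻¹ * ∫ y in (0:ℝ)..1, ‖G' y‖ ^ 2 := by
  have e : ∀ y, (‖rescale' r G' y‖ ^ 2 : ℝ) = (1 / r) ^ 2 * ‖G' (y / r)‖ ^ 2 := by
    intro y
    rw [rescale', norm_mul, Complex.norm_real, Real.norm_eq_abs, abs_of_pos (one_div_pos.mpr hr), mul_pow]
  simp_rw [e]
  rw [intervalIntegral.integral_const_mul]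
  -- pass through `ℂ` to use the change of variables
  have key := integral_comp_div_unit (F := fun y => ((‖G' y‖ ^ 2 : ℝ) : ℂ)) hr hr1
    (fun y hy => by rw [h.deriv_eq_zero y hy, norm_zero]; simp) (h.intervalIntegrable_normSq' 0 1)
  have k2 : ((∫ y in (0:ℝ)..1, ‖G' (y / r)‖ ^ 2 : ℝ) : ℂ) = (r : ℂ) * ((∫ y in (0:ℝ)..1, ‖G' y‖ ^ 2 : ℝ) : ℂ) := by
    rw [← intervalIntegral.integral_ofReal, ← intervalIntegral.integral_ofReal]
    exact key
  have k3 : (∫ y in (0:ℝ)..1, ‖G' (y / r)‖ ^ 2) = r * ∫ y in (0:ℝ)..1, ‖G' y‖ ^ 2 := by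
    exact_mod_cast k2
  rw [k3]
  field_simp

/-- `∫₀¹ (rescale′ r G′)·conj(rescale r G) = ∫₀¹ G′·conj G` (scale invariant). [cite: Zhang2022LandauSiegel, §2 (2.10), (2.30)] -/
theorem integral_rescale'_mul_conj (h : OnePieceWV G G') {r : ℝ} (hr : 0 < r) (hr1 : r ≤ 1) :
    ∫ y in (0:ℝ)..1, rescale' r G' y * conj (rescale r G y) = ∫ y in (0:ℝ)..1, G' y * conj (G y) := by
  have e : ∀ y, rescale' r G' y * conj (rescale r G y) =
      ((1 / r : ℝ) : ℂ) * (G' (y / r) * conj (G (y / r))) := by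
    intro y; simp only [rescale', rescale]; ring
  simp_rw [e]
  rw [intervalIntegral.integral_const_mul,
    integral_comp_div_unit (F := fun y => G' y * conj (G y)) hr hr1
      (fun y hy => by rw [h.eq_zero y hy, map_zero, mul_zero]) (h.intervalIntegrable_deriv_mul_conj 0 1)]
  have hr' : (r : ℂ) ≠ 0 := Complex.ofReal_ne_zero.mpr hr.ne'
  push_cast
  field_simp

/-- `∫₀¹ ‖rescale r G‖² = r·∫₀¹ ‖G‖²`. [cite: Zhang2022LandauSiegel, §2 (2.10), (2.30)] -/
theorem integral_normSq_rescale (h : OnePieceWV G G') {r : ℝ} (hr : 0 < r) (hr1 : r ≤ 1) :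
    ∫ y in (0:ℝ)..1, ‖rescale r G y‖ ^ 2 = r * ∫ y in (0:ℝ)..1, ‖G y‖ ^ 2 := by
  have key := integral_comp_div_unit (F := fun y => ((‖G y‖ ^ 2 : ℝ) : ℂ)) hr hr1
    (fun y hy => by rw [h.eq_zero y hy, norm_zero]; simp)
    (by
      have hc : Continuous fun y => ((‖G y‖ ^ 2 : ℝ) : ℂ) := by
        have := h.continuous; fun_prop
      exact hc.intervalIntegrable 0 1)
  have k2 : ((∫ y in (0:ℝ)..1, ‖G (y / r)‖ ^ 2 : ℝ) : ℂ) = (r : ℂ) * ((∫ y in (0:ℝ)..1, ‖G y‖ ^ 2 : ℝ) : ℂ) := by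
    rw [← intervalIntegral.integral_ofReal, ← intervalIntegral.integral_ofReal]
    exact key
  simp only [rescale]
  exact_mod_cast k2

/-- `∫₀¹ rescale r G = r·∫₀¹ G`. [cite: Zhang2022LandauSiegel, §2 (2.10), (2.30)] -/
theorem integral_rescale (h : OnePieceWV G G') {r : ℝ} (hr : 0 < r) (hr1 : r ≤ 1) :
    ∫ y in (0:ℝ)..1, rescale r G y = (r : ℂ) * ∫ y in (0:ℝ)..1, G y := by
  simp only [rescale]
  exact integral_comp_div_unit hr hr1 h.eq_zero (h.intervalIntegrable 0 1)

/-- The primitive of the rescaled profile: `∫₀ʸ rescale r G = r·∫₀^{y/r} G`. [cite: Zhang2022LandauSiegel, §2 (2.10), (2.30)] -/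
theorem primitive_rescale (G : ℝ → ℂ) {r : ℝ} (hr : r ≠ 0) (y : ℝ) :
    ∫ t in (0:ℝ)..y, rescale r G t = (r : ℂ) * ∫ t in (0:ℝ)..(y / r), G t := by
  simp only [rescale]
  rw [intervalIntegral.integral_comp_div G hr, zero_div, Complex.real_smul]

/-- `∫₀¹ (rescale r G)(y)·conj(∫₀ʸ rescale r G) dy = r²·∫₀¹ G·conj(∫₀ʸ G)`. [cite: Zhang2022LandauSiegel, §2 (2.10), (2.30)] -/
theorem integral_rescale_mul_conj_primitive (h : OnePieceWV G G') {r : ℝ} (hr : 0 < r) (hr1 : r ≤ 1) :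
    ∫ y in (0:ℝ)..1, rescale r G y * conj (∫ t in (0:ℝ)..y, rescale r G t) =
      (r : ℂ) ^ 2 * ∫ y in (0:ℝ)..1, G y * conj (∫ t in (0:ℝ)..y, G t) := by
  have e : ∀ y, rescale r G y * conj (∫ t in (0:ℝ)..y, rescale r G t) =
      (fun s => (r : ℂ) * (G s * conj (∫ t in (0:ℝ)..s, G t))) (y / r) := by
    intro y
    rw [primitive_rescale G hr.ne' y]
    simp only [rescale, map_mul, Complex.conj_ofReal]
    ring
  simp_rw [e]
  rw [integral_comp_div_unit (F := fun s => (r : ℂ) * (G s * conj (∫ t in (0:ℝ)..s, G t))) hr hr1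
      (fun y hy => by simp only [h.eq_zero y hy, zero_mul, mul_zero])
      ((h.intervalIntegrable_mul_conj_primitive 0 1).const_mul _),
    intervalIntegral.integral_const_mul]
  ring

/-- **The frame scaling law.** For a one-piece wall-vanishing profile and `0 < r ≤ 1`:
`F_ℓ(rescale r G) = r⁻¹·F_{ℓr}(G)` — shrinking the support by `r` at spacing parameter `ℓ` is evaluating at spacing
parameter `ℓr`, up to the factor `r⁻¹`. [cite: Zhang2022LandauSiegel, §2 (2.10) p.4 (zero spacing α = π/log P), (2.30)] -/
theorem mainTermFormEll_rescale (h : OnePieceWV G G') (ℓ : ℝ) {r : ℝ} (hr : 0 < r) (hr1 : r ≤ 1) :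
    mainTermFormEll ℓ (rescale r G) (rescale' r G') = r⁻¹ * mainTermFormEll (ℓ * r) G G' := by
  have hT1 := integral_normSq_rescale' h hr hr1
  have hT2 := integral_rescale'_mul_conj h hr hr1
  have hT3 := integral_normSq_rescale h hr hr1
  have hI := integral_rescale h hr hr1
  have hT5 := integral_rescale_mul_conj_primitive h hr hr1
  have h0 : rescale r G 0 = G 0 := by simp [rescale]
  have h1 : rescale r G 1 = 0 := by
    simp only [rescale]
    exact h.eq_zero _ (by rw [le_div_iff₀ hr, one_mul]; exact hr1)
  have hG1 : G 1 = 0 := h.eq_zero 1 le_rfl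
  rw [mainTermFormEll, mainTermFormEll, hT1, hT2, hT3, hI, hT5, h0, h1, hG1]
  have hr' : r ≠ 0 := hr.ne'
  have e2 : ((r : ℂ) ^ 2) = ((r ^ 2 : ℝ) : ℂ) := by push_cast; ring
  rw [e2]
  simp only [map_zero, mul_zero, add_zero, Complex.zero_im, map_mul, Complex.conj_ofReal,
    Complex.mul_re, Complex.mul_im, Complex.ofReal_re, Complex.ofReal_im, zero_mul, sub_zero]
  field_simp

/-- `F_s(G) = s·𝔅(rescale s G)` for `0 < s ≤ 1`: below the physical point the deformed form IS a value of the
manuscript's form `𝔅` (on the shrunk profile). [cite: Zhang2022LandauSiegel, §2 (2.10) p.4 (zero spacing α = π/log P), (2.30)] -/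
theorem mainTermFormEll_eq_mul_mainTermForm_rescale (h : OnePieceWV G G') {s : ℝ} (hs : 0 < s) (hs1 : s ≤ 1) :
    mainTermFormEll s G G' = s * mainTermForm (rescale s G) (rescale' s G') := by
  have key := mainTermFormEll_rescale h 1 hs hs1
  rw [mainTermFormEll_one, one_mul] at key
  rw [key]
  field_simp

/-- `F_ℓ(rescale r G) = ℓ·𝔅(rescale (ℓr) G)` whenever `0 < r ≤ 1`, `0 < ℓ`, `ℓr ≤ 1`. [cite: Zhang2022LandauSiegel, §2 (2.10) p.4 (zero spacing α = π/log P), (2.30)] -/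
theorem mainTermFormEll_rescale_eq_mul_mainTermForm (h : OnePieceWV G G') {ℓ r : ℝ} (hr : 0 < r) (hr1 : r ≤ 1)
    (hℓ : 0 < ℓ) (hℓr : ℓ * r ≤ 1) :
    mainTermFormEll ℓ (rescale r G) (rescale' r G') =
      ℓ * mainTermForm (rescale (ℓ * r) G) (rescale' (ℓ * r) G') := by
  rw [mainTermFormEll_rescale h ℓ hr hr1,
    mainTermFormEll_eq_mul_mainTermForm_rescale h (mul_pos hℓ hr) hℓr]
  field_simp

/-! ## The rescaled profile is `H¹`, hence the main term is `≥ 0` for `ℓr ≤ 1` -/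

/-- `rescale s G` (with right derivative `rescale′ s G′`) is an `H¹[0,1]` profile for every `s > 0` — the glue at
`y = s` is continuous because `G(1) = 0`. [cite: Zhang2022LandauSiegel, §2 (2.10), (2.23)–(2.25), (2.30)] -/
theorem isH1_rescale (h : OnePieceWV G G') {s : ℝ} (hs : 0 < s) :
    IsH1OnUnitInterval (rescale s G) (rescale' s G') := by
  obtain ⟨C, hC⟩ := h.bounded
  refine isH1_of_hasDerivWithinAt_Ioi ?_ ?_ ?_
  · exact (h.continuous.comp (continuous_id.div_const s)).continuousOn
  · intro x hx
    have hxs : 0 < x / s := div_pos hx.1 hs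
    have hG := h.hasDerivWithinAt (x / s) hxs
    have hh : HasDerivWithinAt (fun y : ℝ => y / s) (1 / s) (Ioi x) x :=
      (hasDerivWithinAt_id x (Ioi x)).div_const s
    have hmaps : MapsTo (fun y : ℝ => y / s) (Ioi x) (Ioi (x / s)) :=
      fun y hy => div_lt_div_of_pos_right hy hs
    have hcomp := hG.scomp x hh hmaps
    have e : (1 / s : ℝ) • G' (x / s) = rescale' s G' x := by
      rw [rescale', Complex.real_smul]
    rw [e] at hcomp
    exact hcomp
  · have hmeas : AEStronglyMeasurable (rescale' s G') (volume.restrict (Ioc (0:ℝ) 1)) := by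
      have : Measurable (rescale' s G') :=
        measurable_const.mul (h.measurable.comp (measurable_id.div_const s))
      exact this.aestronglyMeasurable
    refine MemLp.of_bound hmeas (1 / s * C) (ae_of_all _ fun y => ?_)
    rw [rescale', norm_mul, Complex.norm_real, Real.norm_eq_abs, abs_of_pos (one_div_pos.mpr hs)]
    exact mul_le_mul_of_nonneg_left (hC _) (one_div_pos.mpr hs).le

/-- **The main term is non-negative below the total rescale `1`**: for a one-piece wall-vanishing profile,
`0 < r ≤ 1`, `0 < ℓ` and `ℓ·r ≤ 1` give `F_ℓ(rescale r G) = ℓ·𝔅(rescale (ℓr) G) ≥ 0` by the PSD theorem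
`mainTermForm_nonneg_of_isH1`. [cite: Zhang2022LandauSiegel, §2 (2.10) p.4 (zero spacing α = π/log P), (2.30)] -/
theorem mainTermFormEll_rescale_nonneg (h : OnePieceWV G G') {ℓ r : ℝ} (hr : 0 < r) (hr1 : r ≤ 1)
    (hℓ : 0 < ℓ) (hℓr : ℓ * r ≤ 1) :
    0 ≤ mainTermFormEll ℓ (rescale r G) (rescale' r G') := by
  rw [mainTermFormEll_rescale_eq_mul_mainTermForm h hr hr1 hℓ hℓr]
  exact mul_nonneg hℓ.le (mainTermForm_nonneg_of_isH1 (isH1_rescale h (mul_pos hℓ hr)))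

end EllRegime

/-! ## The typed frame: `ℓ(P)·(L_M/L_R) = L_M/L_Δ < 1` -/

namespace EllScales

namespace Scales

variable (S : Scales)

/-- **The total rescale of the physical frame**: `ℓ(P)·(L_M/L_R(P)) = log P/L_Δ(P)` (the spacing parameter
`L_R/L_Δ` times the frame factor `L_M/L_R`). [cite: Zhang2022LandauSiegel, §2 (2.10), (2.30)] -/
theorem ellP_mul_shrink (hR : S.LRefl S.P ≠ 0) : S.ellP * S.shrink = S.logP / S.LDelta S.P := by
  unfold ellP ell shrink
  rw [div_mul_div_comm, mul_comm (S.LRefl S.P), mul_div_mul_right _ _ hR]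

/-- `L_Δ(P) = log P + log √D + log t₀`. [cite: Zhang2022LandauSiegel, §2 (2.10)] -/
theorem LDelta_P_eq (hD : (0:ℝ) < S.D) (ht : 0 < S.t0) :
    S.LDelta S.P = S.logP + Real.log (Real.sqrt S.D) + Real.log S.t0 := by
  have hP : Real.exp S.logP ≠ 0 := (Real.exp_pos _).ne'
  have hs : Real.sqrt (S.D : ℝ) ≠ 0 := Real.sqrt_ne_zero'.mpr hD
  rw [LDelta, P, Real.log_mul (mul_ne_zero hP hs) ht.ne', Real.log_mul hP hs, Real.log_exp]

/-- `L_R(P) = log P + log D + log t₀ − log 2π`. [cite: Zhang2022LandauSiegel, §2 (2.30)] -/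
theorem LRefl_P_eq (hD : (0:ℝ) < S.D) (ht : 0 < S.t0) :
    S.LRefl S.P = S.logP + Real.log S.D + Real.log S.t0 - Real.log (2 * π) := by
  have hP : Real.exp S.logP ≠ 0 := (Real.exp_pos _).ne'
  have h2π : (2 * π : ℝ) ≠ 0 := by positivity
  rw [LRefl, P, Real.log_div (mul_ne_zero (mul_ne_zero hP hD.ne') ht.ne') h2π,
    Real.log_mul (mul_ne_zero hP hD.ne') ht.ne', Real.log_mul hP hD.ne', Real.log_exp]

/-- **Frame bounds in the regime.** For `A > 0` and `D ≥ 7` (so `log D > 1`, `t₀ = 𝓛⁵¹⁹ ≥ 1`, `Dt₀ > 2π`),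
every scale record of the `P`-side regime has `0 < L_M/L_R ≤ 1`, `0 < ℓ(P)` and `0 < ℓ(P)·(L_M/L_R) < 1`
(`= log P/(log P + ½log D + log t₀)`). [cite: Zhang2022LandauSiegel, §2 (2.6), (2.8), (2.10), (2.30)] -/
theorem IsEllRegimeP.frame_bounds {S : Scales} {A : ℝ} (h : S.IsEllRegimeP A) (hA : 0 < A) (hD : 7 ≤ S.D) :
    0 < S.shrink ∧ S.shrink ≤ 1 ∧ 0 < S.ellP ∧ 0 < S.ellP * S.shrink ∧ S.ellP * S.shrink < 1 := by
  obtain ⟨hP, ht0, -, -, -⟩ := id h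
  have hD7 : (7 : ℝ) ≤ S.D := by exact_mod_cast hD
  have hD0 : (0 : ℝ) < S.D := by linarith
  have hD1 : (1 : ℝ) < S.D := by linarith
  -- `log D > 1` (since `D ≥ 7 > e`)
  have hlogD : 1 < Real.log S.D := by
    rw [← Real.exp_lt_exp, Real.exp_log hD0]
    have := Real.exp_one_lt_d9
    linarith
  have hlogD0 : 0 < Real.log S.D := by linarith
  have ht : S.t0 = Real.log S.D ^ 519 := ht0
  have ht1 : 1 ≤ S.t0 := by rw [ht]; exact one_le_pow₀ hlogD.le
  have ht0' : 0 < S.t0 := by linarith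
  have hlogt : 0 ≤ Real.log S.t0 := Real.log_nonneg ht1
  have hlogP : 0 < S.logP := by rw [hP]; exact mul_pos hA hlogD0
  have hsqrt : 0 < Real.log (Real.sqrt S.D) := by
    rw [Real.log_sqrt hD0.le]; linarith
  -- `log(2π) < log 7 ≤ log D`
  have h2π : Real.log (2 * π) < Real.log S.D := by
    apply Real.log_lt_log (by positivity)
    have := Real.pi_lt_d2
    linarith
  have hΔ : S.logP < S.LDelta S.P := by
    rw [S.LDelta_P_eq hD0 ht0']; linarith
  have hΔ0 : 0 < S.LDelta S.P := by linarith
  have hR : S.logP ≤ S.LRefl S.P := by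
    rw [S.LRefl_P_eq hD0 ht0']; linarith
  have hR0 : 0 < S.LRefl S.P := by linarith
  have hshrink0 : 0 < S.shrink := by unfold shrink; exact div_pos hlogP hR0
  have hshrink1 : S.shrink ≤ 1 := by unfold shrink; rw [div_le_one hR0]; exact hR
  have hell0 : 0 < S.ellP := by unfold ellP ell; exact div_pos hR0 hΔ0
  have hprod : S.ellP * S.shrink = S.logP / S.LDelta S.P := S.ellP_mul_shrink hR0.ne'
  refine ⟨hshrink0, hshrink1, hell0, mul_pos hell0 hshrink0, ?_⟩
  rw [hprod, div_lt_one hΔ0]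
  exact hΔ

end Scales

end EllScales

/-! ## Consequence for the one-piece positivity endgame in the physical frame -/

namespace EllRegime

open EllScales

variable {G G' : ℝ → ℂ}

/-- **The main term of `hneg` is non-negative** for every one-piece wall-vanishing profile, at every scale record
of the `P`-side regime with `A > 0`, `D ≥ 7`: `0 ≤ F_{ℓ(P)}(rescale (L_M/L_R) G)`.
[cite: Zhang2022LandauSiegel, §2 (2.10) p.4 (zero spacing α = π/log P), (2.30)] -/
theorem mainTerm_frame_nonneg (h : OnePieceWV G G') {S : Scales} {A : ℝ} (hS : S.IsEllRegimeP A)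
    (hA : 0 < A) (hD : 7 ≤ S.D) :
    0 ≤ mainTermFormEll S.ellP (rescale S.shrink G) (rescale' S.shrink G') := by
  obtain ⟨hs0, hs1, hl0, -, hprod⟩ := hS.frame_bounds hA hD
  exact mainTermFormEll_rescale_nonneg h hs0 hs1 hl0 hprod.le

/-- **A one-piece POS design closes only through the dictionary term.** If the closing inequality of
`theorem1_of_ellDictProfile` holds at a scale record of the regime (`A > 0`, `D ≥ 7`) for a one-piece
wall-vanishing profile, then `(G₀ + λG₁)/A + K/A² < 0` for every `|λ| ≤ Λ`: the first-order dictionary term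
(registry row E-022) must be NEGATIVE and exceed the (non-negative) main term. [cite: Zhang2022LandauSiegel, §2 (2.10), (2.30); §8 (8.23)] -/
theorem dict_neg_of_hneg (h : OnePieceWV G G') {S : Scales} {A G₀ G₁ Λ K : ℝ} (hS : S.IsEllRegimeP A)
    (hA : 0 < A) (hD : 7 ≤ S.D)
    (hneg : ∀ lam : ℝ, |lam| ≤ Λ →
      mainTermFormEll S.ellP (rescale S.shrink G) (rescale' S.shrink G') + (G₀ + lam * G₁) / A + K / A ^ 2 < 0)
    {lam : ℝ} (hlam : |lam| ≤ Λ) : (G₀ + lam * G₁) / A + K / A ^ 2 < 0 := by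
  have h0 := mainTerm_frame_nonneg h hS hA hD
  have h1 := hneg lam hlam
  linarith

/-- In particular (`λ = 0`): `G₀/A + K/A² < 0`, i.e. `G₀ < −K/A` — the dictionary's `λ`-free constant must be
negative. [cite: Zhang2022LandauSiegel, §2 (2.10), (2.30); §8 (8.23)] -/
theorem dict0_neg_of_hneg (h : OnePieceWV G G') {S : Scales} {A G₀ G₁ Λ K : ℝ} (hS : S.IsEllRegimeP A)
    (hA : 0 < A) (hD : 7 ≤ S.D) (hΛ : 0 ≤ Λ)
    (hneg : ∀ lam : ℝ, |lam| ≤ Λ →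
      mainTermFormEll S.ellP (rescale S.shrink G) (rescale' S.shrink G') + (G₀ + lam * G₁) / A + K / A ^ 2 < 0) :
    G₀ / A + K / A ^ 2 < 0 := by
  have := dict_neg_of_hneg h hS hA hD hneg (lam := 0) (by rw [abs_zero]; exact hΛ)
  simpa using this

end EllRegime

end Literature.NumberTheory.LFunctions.Zhang2022
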